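import Summits.SmoothPoincare4.SmoothPoincare4.Theorems.SullivanDualWitnessChargeSubstubFar
import Summits.SmoothPoincare4.SmoothPoincare4.Theorems.SullivanDualWitnessChargeCompletePackagingPullback
import Mathlib.Analysis.Normed.Module.Connected
import Mathlib.LinearAlgebra.Complex.FiniteDimensional

/-!
# Sub-stub `substub_completePackaging` of the hard stub `stub_pencilOrRescale`, part 2: packaging a
complete pencil (crux `WitnessCharge`, stmt-SmoothPoincare4-7824, route `SullivanDual`, line
`Sketch`; card `Cruxes/WitnessCharge/Lines/Sketch.md` (P6))

Given a global diffeomorphism `F : ℂ × ℂ ≃ₘ Σ∖p` whose slices `F(b, ·)` are pencil members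
(`IsPencilMember`, Defs file) and which IS the far flat line for large intercepts
(`Ycoord ∘ F = swap` on `{‖b‖ > R₀}`), we produce the complete-pencil data `CompletePencilData S p J`
(Defs file) with the SAME `F` and the pulled-back structure `Ĵ = F^*J` (`pullbackJ`, part 1,
`SullivanDualWitnessChargeCompletePackagingPullback.lean`: conjugation, `Ĵ² = -1`, holomorphic
slices, continuity). Here:

* the transverse part `P_q w = (Ĵ_q (w, 0)).1` (a complex structure on the plane by part 1) equals
  `w ↦ i w` at a far parameter `q₀ = (b₀, 0)`, `‖b₀‖ > R₀`: there `J` is standard in the flat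
  coordinates (`Dψ ∘ J = J₀ ∘ Dψ`, `complexify ∘ J₀ = (i ⊕ i) ∘ complexify`) and differentiating
  `Ycoord ∘ F = swap` gives `complexify ∘ Dψ ∘ dF = swap`, so `Ĵ_{q₀} = i ⊕ i`;
* hence `dA(w, P_{q₀} w) = ‖w‖² > 0`, and the sign of `dA(w, P_q w)` is constant over the connected
  parameter space `ℂ × ℂ` (`areaForm_self_pos_of_preconnected`: a complex structure on the plane
  is never radial), which is the orientation clause of `CompletePencilData`.
-/

noncomputable section

-- the prescribed namespace `Summit.<P>.<Sub>.…` duplicates `SmoothPoincare4` (P = Sub)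
set_option linter.dupNamespace false

open scoped Manifold ContDiff Topology
open Set Filter Literature.Geometry.Kaehler Literature.Geometry.Symplectic
  Literature.Topology.FourManifolds

namespace Summit.SmoothPoincare4.SmoothPoincare4.Theorems.WitnessCharge.PencilIncompleteness

/-! ### Constancy of the transverse orientation (planar linear algebra) -/

/-- The area form of `ℂ = ℝ²`: `dA(a, b) = a.re b.im − a.im b.re`. -/
def areaForm (a b : ℂ) : ℝ := a.re * b.im - a.im * b.re

/-- `dA(w, v) = 0` with `w ≠ 0` forces `v` to be a real multiple of `w`. -/
theorem exists_smul_of_areaForm_eq_zero {w v : ℂ} (hw : w ≠ 0) (h : areaForm w v = 0) :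
    ∃ t : ℝ, v = t • w := by
  have hn : w.re ^ 2 + w.im ^ 2 ≠ 0 := by
    intro h0
    apply hw
    have hre : w.re = 0 := by nlinarith [sq_nonneg w.re, sq_nonneg w.im]
    have him : w.im = 0 := by nlinarith [sq_nonneg w.re, sq_nonneg w.im]
    exact Complex.ext hre him
  refine ⟨(v.re * w.re + v.im * w.im) / (w.re ^ 2 + w.im ^ 2), ?_⟩
  unfold areaForm at h
  apply Complex.ext
  · simp only [Complex.real_smul, Complex.mul_re, Complex.ofReal_re, Complex.ofReal_im, zero_mul,
      sub_zero]
    rw [div_mul_eq_mul_div, eq_div_iff hn]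
    linear_combination (-w.im) * h
  · simp only [Complex.real_smul, Complex.mul_im, Complex.ofReal_re, Complex.ofReal_im, zero_mul,
      add_zero]
    rw [div_mul_eq_mul_div, eq_div_iff hn]
    linear_combination w.re * h

/-- A complex structure `P` on the real plane (`P (P w) = -w`) is never "radial":
`dA(w, P w) ≠ 0` for `w ≠ 0` (else `P w = t w` with `t² = -1`). -/
theorem areaForm_self_ne_zero (P : ℂ →L[ℝ] ℂ) (hP : ∀ w, P (P w) = -w) {w : ℂ} (hw : w ≠ 0) :
    areaForm w (P w) ≠ 0 := by
  intro h
  obtain ⟨t, ht⟩ := exists_smul_of_areaForm_eq_zero hw h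
  have h2 : P (P w) = (t * t) • w := by
    rw [ht, map_smul, ht, smul_smul]
  rw [hP] at h2
  have h3 : (t * t + 1) • w = 0 := by
    rw [add_smul, one_smul, ← h2, neg_add_cancel]
  rcases smul_eq_zero.1 h3 with h4 | h4
  · nlinarith [sq_nonneg t]
  · exact hw h4

/-- For a fixed complex structure `P` on the plane the sign of `dA(w, P w)` does not depend on
`w ≠ 0` (`ℂ ∖ 0` is connected): positivity at `w = 1` gives positivity everywhere. -/
theorem areaForm_self_pos_of_pos_one (P : ℂ →L[ℝ] ℂ) (hP : ∀ w, P (P w) = -w)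
    (h1 : 0 < areaForm 1 (P 1)) {w : ℂ} (hw : w ≠ 0) : 0 < areaForm w (P w) := by
  have hcont : Continuous fun w : ℂ => areaForm w (P w) := by
    unfold areaForm
    fun_prop
  have hconn : IsPreconnected ({0}ᶜ : Set ℂ) :=
    (isConnected_compl_singleton_of_one_lt_rank
      (by rw [Complex.rank_real_complex]; norm_num) 0).isPreconnected
  -- the image of the connected set `ℂ ∖ 0` misses `0`, contains a positive value, hence is positive
  by_contra hle
  rw [not_lt] at hle
  have hlt : areaForm w (P w) < 0 := lt_of_le_of_ne hle (areaForm_self_ne_zero P hP hw)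
  have h0 : (0 : ℝ) ∈ Icc (areaForm w (P w)) (areaForm 1 (P 1)) := ⟨hlt.le, h1.le⟩
  obtain ⟨z, hz, hz0⟩ := hconn.intermediate_value (show w ∈ ({0}ᶜ : Set ℂ) from hw)
    (show (1 : ℂ) ∈ ({0}ᶜ : Set ℂ) from one_ne_zero) hcont.continuousOn h0
  exact areaForm_self_ne_zero P hP hz hz0

/-- **Constancy of the transverse orientation.** A continuous family `P : X → (ℂ →L[ℝ] ℂ)` of
complex structures on the plane over a preconnected space, positively oriented at one parameter
`q₀`, is positively oriented everywhere: `0 < dA(w, P q w)` for all `q` and `w ≠ 0`. -/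
theorem areaForm_self_pos_of_preconnected {X : Type*} [TopologicalSpace X] [PreconnectedSpace X]
    (P : X → (ℂ →L[ℝ] ℂ)) (hc : Continuous P) (hP : ∀ q w, P q (P q w) = -w)
    (q₀ : X) (h₀ : ∀ w : ℂ, w ≠ 0 → 0 < areaForm w (P q₀ w)) :
    ∀ (q : X) (w : ℂ), w ≠ 0 → 0 < areaForm w (P q w) := by
  -- the sign at `w = 1` is a continuous nowhere-vanishing function of `q`
  have hf : Continuous fun q => areaForm 1 (P q 1) := by
    have h1 : Continuous fun q => P q 1 := hc.clm_apply continuous_const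
    unfold areaForm
    fun_prop
  have hne : ∀ q, areaForm 1 (P q 1) ≠ 0 := fun q => areaForm_self_ne_zero (P q) (hP q) one_ne_zero
  have hpos : ∀ q, 0 < areaForm 1 (P q 1) := by
    intro q
    rcases lt_or_gt_of_ne (hne q) with hlt | hgt
    · exfalso
      have h0 : (0 : ℝ) ∈ Icc (areaForm 1 (P q 1)) (areaForm 1 (P q₀ 1)) :=
        ⟨hlt.le, (h₀ 1 one_ne_zero).le⟩
      obtain ⟨z, -, hz0⟩ := isPreconnected_univ.intermediate_value (mem_univ q) (mem_univ q₀)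
        hf.continuousOn h0
      exact hne z hz0
    · exact hgt
  intro q w hw
  exact areaForm_self_pos_of_pos_one (P q) (hP q) (hpos q) hw

/-! ### Flat linear algebra: complexification `ℝ⁴ → ℂ × ℂ` and the swap -/

variable {S : HomotopySphere 4}

/-- Local notation for the model space `ℝ⁴`. -/
local notation "E4" => EuclideanSpace ℝ (Fin 4)

/-- Complexification `y ↦ (y₀ + i y₁, y₂ + i y₃)` of `ℝ⁴`, so that `Ycoord p = complexify ∘ ψ`. -/
def complexify (y : E4) : ℂ × ℂ := (⟨y 0, y 1⟩, ⟨y 2, y 3⟩)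

/-- Real part of the first component of `complexify y`. -/
@[simp] theorem complexify_fst_re (y : E4) : (complexify y).1.re = y 0 := rfl
/-- Imaginary part of the first component of `complexify y`. -/
@[simp] theorem complexify_fst_im (y : E4) : (complexify y).1.im = y 1 := rfl
/-- Real part of the second component of `complexify y`. -/
@[simp] theorem complexify_snd_re (y : E4) : (complexify y).2.re = y 2 := rfl
/-- Imaginary part of the second component of `complexify y`. -/
@[simp] theorem complexify_snd_im (y : E4) : (complexify y).2.im = y 3 := rfl

/-- `complexify` as a continuous `ℝ`-linear map. -/
def complexifyL : E4 →L[ℝ] ℂ × ℂ :=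
  LinearMap.toContinuousLinearMap
    { toFun := complexify
      map_add' := fun a b => by
        apply Prod.ext <;> apply Complex.ext <;> simp
      map_smul' := fun c a => by
        apply Prod.ext <;> apply Complex.ext <;> simp }

/-- `complexifyL` is `complexify`. -/
@[simp] theorem complexifyL_apply (y : E4) : complexifyL y = complexify y := rfl

/-- `complexify` intertwines `J₀` with multiplication by `i` in both factors. -/
theorem complexify_J0 (a : E4) :
    complexify (J0 a) = (Complex.I * (complexify a).1, Complex.I * (complexify a).2) := by
  apply Prod.ext <;> apply Complex.ext <;> simp

/-- The complex flat coordinates are the complexification of the flat coordinates `ψ = ι(e − e p)`. -/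
theorem Ycoord_eq_complexify (p : S.carrier) (x : punctured p) :
    Ycoord p x = complexify (inversion (extChartAt (𝓡 4) p x.1 - extChartAt (𝓡 4) p p)) := rfl

/-- The swap `(z, w) ↦ (w, z)` of `ℂ × ℂ` as a continuous `ℝ`-linear map. -/
def swapL : ℂ × ℂ →L[ℝ] ℂ × ℂ :=
  (ContinuousLinearMap.snd ℝ ℂ ℂ).prod (ContinuousLinearMap.fst ℝ ℂ ℂ)

/-- `swapL (z, w) = (w, z)`. -/
@[simp] theorem swapL_apply (u : ℂ × ℂ) : swapL u = (u.2, u.1) := rfl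

/-! ### The far parameter: `Ĵ = i ⊕ i` where `F` is the far flat line -/

section Far

variable {p : S.carrier} (J : ∀ x : punctured p, TangentSpace (𝓡 4) x →L[ℝ] TangentSpace (𝓡 4) x)
  (F : (ℂ × ℂ) ≃ₘ⟮𝓘(ℝ, ℂ × ℂ), 𝓡 4⟯ (punctured p))

/-- The flat coordinate map `ψ x = ι(e x − e p)` on `Σ ∖ p`. -/
def psi (p : S.carrier) (x : punctured p) : E4 :=
  inversion (extChartAt (𝓡 4) p x.1 - extChartAt (𝓡 4) p p)

/-- The differential `Dψ(x) = Dι(e x − e p) ∘ D(e ∘ val)(x)` of `ψ`. -/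
def Dpsi (p : S.carrier) (x : punctured p) : E4 →L[ℝ] E4 :=
  (fderiv ℝ inversion (extChartAt (𝓡 4) p x.1 - extChartAt (𝓡 4) p p)).comp
    (mfderiv (𝓡 4) 𝓘(ℝ, EuclideanSpace ℝ (Fin 4))
      (fun z : punctured p => extChartAt (𝓡 4) p z.1) x)

/-- Unfolding `Dpsi`. -/
theorem Dpsi_apply (x : punctured p) (v : TangentSpace (𝓡 4) x) :
    Dpsi p x v = fderiv ℝ inversion (extChartAt (𝓡 4) p x.1 - extChartAt (𝓡 4) p p)
      (mfderiv (𝓡 4) 𝓘(ℝ, EuclideanSpace ℝ (Fin 4))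
        (fun z : punctured p => extChartAt (𝓡 4) p z.1) x v) := rfl

variable {ε' R₀ : ℝ}

/-- Standardness of `J` on the punctured `ε'`-ball reads `Dψ ∘ J = J₀ ∘ Dψ`. -/
theorem Dpsi_J
    (hJstd : ∀ x : punctured p, InPuncturedChartBall p ε' x →
      ∀ (v : TangentSpace (𝓡 4) x) (b : EuclideanSpace ℝ (Fin 4)),
        inner ℝ (fderiv ℝ inversion (extChartAt (𝓡 4) p x.1 - extChartAt (𝓡 4) p p)
          (mfderiv (𝓡 4) 𝓘(ℝ, EuclideanSpace ℝ (Fin 4))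
            (fun z : punctured p => extChartAt (𝓡 4) p z.1) x (J x v))) b
        = stdSymplecticForm (fderiv ℝ inversion (extChartAt (𝓡 4) p x.1 - extChartAt (𝓡 4) p p)
          (mfderiv (𝓡 4) 𝓘(ℝ, EuclideanSpace ℝ (Fin 4))
            (fun z : punctured p => extChartAt (𝓡 4) p z.1) x v)) b)
    {x : punctured p} (hx : InPuncturedChartBall p ε' x) (v : TangentSpace (𝓡 4) x) :
    Dpsi p x (J x v) = J0 (Dpsi p x v) := by
  apply eq_of_inner_eq
  intro c
  rw [inner_J0, Dpsi_apply, Dpsi_apply]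
  exact hJstd x hx v c

/-- On the far region `{R₀ < ‖b‖}` the map `F` is the far flat line: differentiating
`Ycoord ∘ F = swap` gives `complexify ∘ Dψ(F q₀) ∘ dF_{q₀} = swap`. -/
theorem complexifyL_comp_Dpsi_comp_mfderiv
    (hfar : ∀ b ξ : ℂ, R₀ < ‖b‖ →
      InPuncturedChartBall p ε' (F (b, ξ)) ∧ Ycoord p (F (b, ξ)) = (ξ, b))
    {q₀ : ℂ × ℂ} (hq₀ : R₀ < ‖q₀.1‖) :
    complexifyL.comp ((Dpsi p (F q₀)).comp (mfderiv 𝓘(ℝ, ℂ × ℂ) (𝓡 4) F q₀)) = swapL := by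
  have hx : InPuncturedChartBall p ε' (F q₀) := (hfar q₀.1 q₀.2 hq₀).1
  have hψ : HasMFDerivAt (𝓡 4) 𝓘(ℝ, E4) (psi p) (F q₀) (Dpsi p (F q₀)) := hasMFDerivAt_psi hx
  have hc : HasMFDerivAt 𝓘(ℝ, E4) 𝓘(ℝ, ℂ × ℂ) complexifyL (psi p (F q₀)) complexifyL :=
    hasMFDerivAt_iff_hasFDerivAt.2 complexifyL.hasFDerivAt
  have h1 : HasMFDerivAt 𝓘(ℝ, ℂ × ℂ) 𝓘(ℝ, ℂ × ℂ) (complexifyL ∘ (psi p ∘ F)) q₀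
      (complexifyL.comp ((Dpsi p (F q₀)).comp (mfderiv 𝓘(ℝ, ℂ × ℂ) (𝓡 4) F q₀))) :=
    hc.comp q₀ (hψ.comp q₀ (hasMFDerivAt_diffeo F q₀))
  have h2 : (complexifyL ∘ (psi p ∘ F) : ℂ × ℂ → ℂ × ℂ) =ᶠ[𝓝 q₀] swapL := by
    have hU : {q : ℂ × ℂ | R₀ < ‖q.1‖} ∈ 𝓝 q₀ :=
      (isOpen_lt continuous_const (continuous_norm.comp continuous_fst)).mem_nhds hq₀
    filter_upwards [hU] with q hq
    have h := (hfar q.1 q.2 hq).2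
    rw [Ycoord_eq_complexify] at h
    show complexify (psi p (F q)) = (q.2, q.1)
    exact h
  have h3 : HasMFDerivAt 𝓘(ℝ, ℂ × ℂ) 𝓘(ℝ, ℂ × ℂ) swapL q₀ swapL :=
    hasMFDerivAt_iff_hasFDerivAt.2 swapL.hasFDerivAt
  exact hasMFDerivAt_unique h1 (h3.congr_of_eventuallyEq h2)

/-- Pointwise form: `complexify (Dψ (dF_{q₀} u)) = (u.2, u.1)` at a far parameter `q₀`. -/
theorem complexify_Dpsi_mfderiv
    (hfar : ∀ b ξ : ℂ, R₀ < ‖b‖ →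
      InPuncturedChartBall p ε' (F (b, ξ)) ∧ Ycoord p (F (b, ξ)) = (ξ, b))
    {q₀ : ℂ × ℂ} (hq₀ : R₀ < ‖q₀.1‖) (u : ℂ × ℂ) :
    complexify (Dpsi p (F q₀) (mfderiv 𝓘(ℝ, ℂ × ℂ) (𝓡 4) F q₀ u)) = (u.2, u.1) := by
  have h := ContinuousLinearMap.ext_iff.1 (complexifyL_comp_Dpsi_comp_mfderiv F hfar hq₀) u
  simp only [ContinuousLinearMap.comp_apply, complexifyL_apply] at h
  exact h

/-- **At a far parameter the transverse part is multiplication by `i`**: `J` is standard in the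
flat coordinates (`Dψ ∘ J = J₀ ∘ Dψ`, `complexify ∘ J₀ = i ∘ complexify`) and `F` is the far flat
line there (`complexify ∘ Dψ ∘ dF = swap`), so `Ĵ_{q₀} = i ⊕ i`. -/
theorem transversePart_far
    (hJstd : ∀ x : punctured p, InPuncturedChartBall p ε' x →
      ∀ (v : TangentSpace (𝓡 4) x) (b : EuclideanSpace ℝ (Fin 4)),
        inner ℝ (fderiv ℝ inversion (extChartAt (𝓡 4) p x.1 - extChartAt (𝓡 4) p p)
          (mfderiv (𝓡 4) 𝓘(ℝ, EuclideanSpace ℝ (Fin 4))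
            (fun z : punctured p => extChartAt (𝓡 4) p z.1) x (J x v))) b
        = stdSymplecticForm (fderiv ℝ inversion (extChartAt (𝓡 4) p x.1 - extChartAt (𝓡 4) p p)
          (mfderiv (𝓡 4) 𝓘(ℝ, EuclideanSpace ℝ (Fin 4))
            (fun z : punctured p => extChartAt (𝓡 4) p z.1) x v)) b)
    (hfar : ∀ b ξ : ℂ, R₀ < ‖b‖ →
      InPuncturedChartBall p ε' (F (b, ξ)) ∧ Ycoord p (F (b, ξ)) = (ξ, b))
    {q₀ : ℂ × ℂ} (hq₀ : R₀ < ‖q₀.1‖) (w : ℂ) :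
    transversePart J F q₀ w = Complex.I * w := by
  have hx : InPuncturedChartBall p ε' (F q₀) := (hfar q₀.1 q₀.2 hq₀).1
  have h1 := complexify_Dpsi_mfderiv F hfar hq₀ (pullbackJ J F q₀ (w, 0))
  rw [mfderiv_pullbackJ, Dpsi_J J hJstd hx, complexify_J0,
    complexify_Dpsi_mfderiv F hfar hq₀ (w, 0)] at h1
  have h2 := congrArg Prod.snd h1
  simp only at h2
  rw [transversePart_apply, ← h2]

end Far

/-! ### The sub-stub -/

/-- **Sub-stub (C-completePackaging) of `stub_pencilOrRescale`: packaging of a complete pencil.**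
A diffeomorphism `F : ℂ × ℂ ≃ₘ Σ∖p` whose slices `F(b, ·)` are pencil members and which is the
far flat line for `‖b‖ > R₀` yields `CompletePencilData S p J`: with `Ĵ = F^*J = dF⁻¹ ∘ J ∘ dF`,
`Ĵ` is continuous (smoothness of `J` and `F` in tangent coordinates), `dF ∘ Ĵ = J ∘ dF`,
`Ĵ(0, ζ) = (0, iζ)` (slices are `J`-holomorphic), and its transverse part is positively
oriented — at a far parameter `Ĵ = i ⊕ i` because `J` is standard in the flat coordinates
`Ycoord`, and the sign is constant (`areaForm_self_pos_of_preconnected`).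
(Line `Sketch`, `Lines/Sketch.md` (P6).) -/
theorem substub_completePackaging :
    ∀ (S : HomotopySphere 4) (p : S.carrier)
      (J : ∀ x : punctured p, TangentSpace (𝓡 4) x →L[ℝ] TangentSpace (𝓡 4) x) (ε ε' : ℝ),
      0 < ε → ε < ε' →
      Metric.closedBall (extChartAt (𝓡 4) p p) ε' ⊆ (extChartAt (𝓡 4) p).target →
      (∀ (x : punctured p) (v : TangentSpace (𝓡 4) x), J x (J x v) = -v) →
      (∀ x₀ : punctured p, ContMDiffAt (𝓡 4) 𝓘(ℝ, EuclideanSpace ℝ (Fin 4) →L[ℝ] EuclideanSpace ℝ (Fin 4)) ∞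
        (inTangentCoordinates (𝓡 4) (𝓡 4) (id : punctured p → punctured p) id (fun x => J x) x₀) x₀) →
      (∀ x : punctured p, InPuncturedChartBall p ε' x →
        ∀ (v : TangentSpace (𝓡 4) x) (b : EuclideanSpace ℝ (Fin 4)),
          inner ℝ (fderiv ℝ inversion (extChartAt (𝓡 4) p x.1 - extChartAt (𝓡 4) p p)
            (mfderiv (𝓡 4) 𝓘(ℝ, EuclideanSpace ℝ (Fin 4))
              (fun z : punctured p => extChartAt (𝓡 4) p z.1) x (J x v))) b
          = stdSymplecticForm (fderiv ℝ inversion (extChartAt (𝓡 4) p x.1 - extChartAt (𝓡 4) p p)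
            (mfderiv (𝓡 4) 𝓘(ℝ, EuclideanSpace ℝ (Fin 4))
              (fun z : punctured p => extChartAt (𝓡 4) p z.1) x v)) b) →
      ∀ (F : (ℂ × ℂ) ≃ₘ⟮𝓘(ℝ, ℂ × ℂ), 𝓡 4⟯ (punctured p)) (R₀ : ℝ),
        (∀ b : ℂ, IsPencilMember J (fun ξ => F (b, ξ)) b) →
        (∀ b ξ : ℂ, R₀ < ‖b‖ →
          InPuncturedChartBall p ε' (F (b, ξ)) ∧ Ycoord p (F (b, ξ)) = (ξ, b)) →
        CompletePencilData S p J := by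
  intro S p J ε ε' _hε _hεε' _hball hJ2 hJs hJstd F R₀ hmem hfar
  refine ⟨F, pullbackJ J F, continuous_pullbackJ J F hJs, mfderiv_pullbackJ J F,
    pullbackJ_slice J F hmem, ?_⟩
  -- the far parameter `q₀ = (|R₀| + 1, 0)`
  have hq₀ : R₀ < ‖((((|R₀| + 1 : ℝ) : ℂ), (0 : ℂ)) : ℂ × ℂ).1‖ := by
    rw [show ((((|R₀| + 1 : ℝ) : ℂ), (0 : ℂ)) : ℂ × ℂ).1 = ((|R₀| + 1 : ℝ) : ℂ) from rfl,
      Complex.norm_real, Real.norm_eq_abs, abs_of_pos (by positivity)]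
    linarith [le_abs_self R₀]
  have h₀ : ∀ w : ℂ, w ≠ 0 →
      0 < areaForm w (transversePart J F ((((|R₀| + 1 : ℝ) : ℂ), (0 : ℂ)) : ℂ × ℂ) w) := by
    intro w hw
    rw [transversePart_far J F hJstd hfar hq₀ w]
    have hn : 0 < Complex.normSq w := Complex.normSq_pos.2 hw
    rw [Complex.normSq_apply] at hn
    simp only [areaForm, Complex.mul_re, Complex.mul_im, Complex.I_re, Complex.I_im, zero_mul,
      one_mul, zero_sub, zero_add]
    nlinarith [hn]
  intro q w hw
  exact areaForm_self_pos_of_preconnected (transversePart J F) (continuous_transversePart J F hJs)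
    (transversePart_transversePart J F hJ2 hmem) _ h₀ q w hw

end Summit.SmoothPoincare4.SmoothPoincare4.Theorems.WitnessCharge.PencilIncompleteness
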